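import Mathlib.FieldTheory.Finite.GaloisField
import Mathlib.FieldTheory.Finite.Basic
import Mathlib.RingTheory.IntegralDomain
import Mathlib.Tactic
import HarnessLib

set_option linter.dupNamespace false -- `Summit.BirchSwinnertonDyer.BirchSwinnertonDyer.Theorems.…` (summit = sub)
set_option autoImplicit false

/-!
# Crux `HeegnerTwistCouplingInSupply` (stmt-BirchSwinnertonDyer-21381) — card `sqrt2-isogeny-heegner-pin`, the `2 ± √2` law behind
# CELL-15: for a prime `p ≡ 15 (mod 16)`, `X⁴ − 4X² + 2` has a root in `𝔽_p` (`TwoPlusSqrtTwoIsSquare`, PROVED)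

Route `BiquadraticEisensteinDescent` (cell `pub/bsd-wall`, row-12 line lead `bsd-line-ibd-p1` g11). The card's second cell (CELL-15, corner
`W = B_p`, `p ≡ 15 (mod 16)`) rests on "`2 ± √2 ∈ (𝔽_p^×)²` for `p ≡ 15 (mod 16)`", i.e. on a root of `X⁴ − 4X² + 2 = (X² − 2)² − 2` in `𝔽_p`
(card: `2 + √2 = (ζ₁₆ + ζ₁₆⁻¹)²`; kernel-checked there only for `p ∈ {31, 47, 79}`). PROOF (here, for all such `p`): in `F = 𝔽_{p²}`
(`GaloisField p 2`) the unit group is cyclic of order `p² − 1`, divisible by `16` since `16 ∣ p + 1`; take `ζ` of order `16`, so `ζ⁸ = −1`;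
`x = ζ + ζ⁻¹` satisfies `(x² − 2)² = ζ⁴ + 2 + ζ⁻⁴ = 2` (as `ζ⁴ + ζ⁻⁴ = ζ⁻⁴(ζ⁸ + 1) = 0`), and `x^p = ζ^p + ζ^{−p} = ζ⁻¹ + ζ = x` because
`p ≡ −1 (mod 16)`; the `p` Frobenius-fixed elements of `F` are exactly the image of `𝔽_p` (they are roots of `X^p − X`), so `x ∈ 𝔽_p`.
THEOREMS ONLY (finite-field algebra); nothing about Selmer groups, `L`-values, the crux or BSD is asserted. Supports
stmt-BirchSwinnertonDyer-21381 (input of the card's CELL-15, whose descent half is not yet typed).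
-/

namespace Summit.BirchSwinnertonDyer.BirchSwinnertonDyer.Theorems.BiquadraticEisensteinDescentHeegnerTwistCouplingInSupplySqrtTwoLaw

open Polynomial

/-- In a field, an element `z` with `z·w = 1` and `z⁸ = −1` has `(z + w)⁴ − 4(z + w)² + 2 = 0` (`= z⁴ + w⁴ = w⁴(z⁸ + 1)`). [folklore] -/
theorem quartic_of_pow_eight_eq_neg_one {F : Type*} [Field F] {z w : F} (hzw : z * w = 1) (h8 : z ^ 8 = -1) :
    (z + w) ^ 4 - 4 * (z + w) ^ 2 + 2 = 0 := by
  have h8' : z ^ 8 + 1 = 0 := by rw [h8]; ring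
  linear_combination w ^ 4 * h8' +
    (-(z ^ 4) * (1 + z * w + z ^ 2 * w ^ 2 + z ^ 3 * w ^ 3) + 4 * z ^ 2 + 4 * w ^ 2 + 6 * (z * w) - 2) * hzw

/-- **Frobenius-fixed elements of a `ZMod p`-field come from `ZMod p`.** In a field `F` that is a `ZMod p`-algebra (`p` prime), an element
with `x^p = x` lies in the image of `ZMod p`: both the image and the fixed set are roots of `X^p − X`, which has at most `p` roots. [folklore] -/
theorem exists_algebraMap_eq_of_pow_eq {p : ℕ} [Fact p.Prime] {F : Type*} [Field F] [Algebra (ZMod p) F] {x : F}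
    (hx : x ^ p = x) : ∃ a : ZMod p, algebraMap (ZMod p) F a = x := by
  classical
  have hp1 : 1 < p := (Fact.out : p.Prime).one_lt
  set q : F[X] := X ^ p - X with hq
  have hq0 : q ≠ 0 := FiniteField.X_pow_card_sub_X_ne_zero F hp1
  have hdeg : q.natDegree = p := FiniteField.X_pow_card_sub_X_natDegree_eq F hp1
  -- the image of `ZMod p` is a set of `p` roots
  set T : Finset F := Finset.univ.image (algebraMap (ZMod p) F) with hT
  have hinj : Function.Injective (algebraMap (ZMod p) F) := (algebraMap (ZMod p) F).injective
  have hTcard : T.card = p := by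
    rw [hT, Finset.card_image_of_injective _ hinj, Finset.card_univ, ZMod.card]
  have hTsub : T ⊆ q.roots.toFinset := by
    intro y hy
    obtain ⟨a, -, rfl⟩ := Finset.mem_image.mp hy
    rw [Multiset.mem_toFinset, Polynomial.mem_roots hq0, Polynomial.IsRoot, hq, eval_sub, eval_pow, eval_X,
      ← map_pow, ZMod.pow_card, sub_self]
  have hRcard : q.roots.toFinset.card ≤ p := by
    calc q.roots.toFinset.card ≤ Multiset.card q.roots := Multiset.toFinset_card_le _
      _ ≤ q.natDegree := Polynomial.card_roots' q
      _ = p := hdeg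
  have hTeq : T = q.roots.toFinset := Finset.eq_of_subset_of_card_le hTsub (by rw [hTcard]; exact hRcard)
  have hxroot : x ∈ q.roots.toFinset := by
    rw [Multiset.mem_toFinset, Polynomial.mem_roots hq0, Polynomial.IsRoot, hq, eval_sub, eval_pow, eval_X, hx, sub_self]
  rw [← hTeq] at hxroot
  obtain ⟨a, -, ha⟩ := Finset.mem_image.mp hxroot
  exact ⟨a, ha⟩

/-- **An element of order `16` in `𝔽_{p²}^×` for `p ≡ 15 (mod 16)`** (`16 ∣ p + 1 ∣ p² − 1`, cyclic unit group). [folklore] -/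
theorem exists_orderOf_eq_sixteen {p : ℕ} [hp : Fact p.Prime] (hp16 : p % 16 = 15) :
    ∃ ζ : (GaloisField p 2)ˣ, orderOf ζ = 16 := by
  classical
  have hcardF : Nat.card (GaloisField p 2) = p ^ 2 := GaloisField.card p 2 (by norm_num)
  have hcardU : Nat.card (GaloisField p 2)ˣ = p ^ 2 - 1 := by
    rw [Nat.card_units, hcardF]
  have h16 : 16 ∣ p ^ 2 - 1 := by
    have h2 := hp.out.two_le
    have : p ^ 2 - 1 = (p + 1) * (p - 1) := by
      zify [show 1 ≤ p ^ 2 from Nat.one_le_pow 2 p (by omega), show 1 ≤ p by omega]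
      ring
    rw [this]
    exact Dvd.dvd.mul_right (by omega) _
  obtain ⟨g, hg⟩ := IsCyclic.exists_generator (α := (GaloisField p 2)ˣ)
  have hog : orderOf g = p ^ 2 - 1 := by
    rw [orderOf_eq_card_of_forall_mem_zpowers hg, hcardU]
  have hog0 : orderOf g ≠ 0 := by
    rw [hog]
    have := hp.out.two_le
    have : 4 ≤ p ^ 2 := by nlinarith
    omega
  exact ⟨g ^ (orderOf g / 16), orderOf_pow_orderOf_div hog0 (hog ▸ h16)⟩

/-- **`TwoPlusSqrtTwoIsSquare`** (card `sqrt2-isogeny-heegner-pin`, typed there; PROVED here): for every prime `p ≡ 15 (mod 16)` the quartic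
`X⁴ − 4X² + 2` has a root in `ZMod p` — i.e. `2 + √2` and `2 − √2` are squares in `𝔽_p` (`x² = 2 ± √2`). [folklore] -/
theorem twoPlusSqrtTwoIsSquare : ∀ p : ℕ, p.Prime → p % 16 = 15 → ∃ x : ZMod p, x ^ 4 - 4 * x ^ 2 + 2 = 0 := by
  intro p hp hp16
  haveI : Fact p.Prime := ⟨hp⟩
  classical
  obtain ⟨ζ, hζ⟩ := exists_orderOf_eq_sixteen (p := p) hp16
  set z : GaloisField p 2 := (ζ : GaloisField p 2) with hz
  set w : GaloisField p 2 := ((ζ⁻¹ : (GaloisField p 2)ˣ) : GaloisField p 2) with hw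
  have hzw : z * w = 1 := by rw [hz, hw, ← Units.val_mul, mul_inv_cancel, Units.val_one]
  have hwz : w * z = 1 := by rw [mul_comm, hzw]
  -- `z¹⁶ = 1`, `z⁸ = −1`
  have h16 : z ^ 16 = 1 := by
    rw [hz, ← Units.val_pow_eq_pow_val, ← hζ, pow_orderOf_eq_one, Units.val_one]
  have h8ne : z ^ 8 ≠ 1 := by
    intro h
    have h' : ζ ^ 8 = 1 := by
      ext
      rw [Units.val_pow_eq_pow_val, Units.val_one]
      exact h
    exact pow_ne_one_of_lt_orderOf (by norm_num) (by rw [hζ]; norm_num) h'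
  have h8 : z ^ 8 = -1 := by
    have hsq : z ^ 8 * z ^ 8 = 1 := by rw [← pow_add]; exact h16
    rcases mul_self_eq_one_iff.mp hsq with h | h
    · exact absurd h h8ne
    · exact h
  -- the root `x = z + w` of the quartic
  have hquart : (z + w) ^ 4 - 4 * (z + w) ^ 2 + 2 = 0 := quartic_of_pow_eight_eq_neg_one hzw h8
  -- Frobenius: `z^p = w`, `w^p = z` since `p ≡ −1 (mod 16)`
  obtain ⟨k, hk⟩ : ∃ k, p = 16 * k + 15 := ⟨p / 16, by omega⟩
  have hz15 : z ^ 15 = w := by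
    have : z ^ 15 * z = 1 := by rw [← pow_succ]; exact h16
    calc z ^ 15 = z ^ 15 * (z * w) := by rw [hzw, mul_one]
      _ = (z ^ 15 * z) * w := by ring
      _ = w := by rw [this, one_mul]
  have hzp : z ^ p = w := by
    rw [congrArg (fun n => z ^ n) hk, pow_add, pow_mul, h16, one_pow, one_mul, hz15]
  have hwp : w ^ p = z := by
    have hw16 : w ^ 16 = 1 := by
      have : (z * w) ^ 16 = 1 := by rw [hzw, one_pow]
      rw [mul_pow, h16, one_mul] at this
      exact this
    have hw15 : w ^ 15 = z := by
      have : w ^ 15 * w = 1 := by rw [← pow_succ]; exact hw16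
      calc w ^ 15 = w ^ 15 * (w * z) := by rw [hwz, mul_one]
        _ = (w ^ 15 * w) * z := by ring
        _ = z := by rw [this, one_mul]
    rw [congrArg (fun n => w ^ n) hk, pow_add, pow_mul, hw16, one_pow, one_mul, hw15]
  have hfix : (z + w) ^ p = z + w := by
    rw [add_pow_char, hzp, hwp, add_comm]
  obtain ⟨a, ha⟩ := exists_algebraMap_eq_of_pow_eq (p := p) hfix
  refine ⟨a, ?_⟩
  apply (algebraMap (ZMod p) (GaloisField p 2)).injective
  rw [map_add, map_sub, map_pow, map_mul, map_pow, ha, map_ofNat, map_ofNat, map_zero]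
  exact hquart

end Summit.BirchSwinnertonDyer.BirchSwinnertonDyer.Theorems.BiquadraticEisensteinDescentHeegnerTwistCouplingInSupplySqrtTwoLaw
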